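import Mathlib
import Literature.Computability.MetaComplexity.SmolenskyDimensionBound

/-!
# The shift map raises the degree by one

The shift map `g ↦ (b ↦ [b₀ = 0] · g(b₁, …, bₙ))` sends Smolensky's degree filtration
`lowDeg (ZMod 2) n k` (the span of the multilinear monomials `x_S`, `|S| ≤ k`, as functions on the
cube `{0,1}ⁿ`) into `lowDeg (ZMod 2) (n + 1) (k + 1)`: the factor `[b₀ = 0] = 1 - x₀ = x_∅ - x_{0}`
has degree `≤ 1`, the re-indexed function `b ↦ g(b₁, …, bₙ)` has degree `≤ k` (a monomial `x_S`
becomes `x_{succ S}` with `|succ S| = |S|`, and `g ↦ g ∘ shift` is linear), and degrees add under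
multiplication. Wave-4 support of line Sketch/LAR (shift inequality of annihilator ranks,
`λ(2m) = −λ(m)`), crux stmt-QuantumAdvantage-1392.
-/

namespace Summit.QuantumAdvantage.DigitPolyUniformity.SketchLAR

open Finset Module
open Literature.Computability.MetaComplexity.Smolensky (CubeFn mono lowDeg)

namespace ShiftMapMem

/-- Re-indexing a monomial along `Fin.succ`: `x_S(b₁, …, bₙ) = x_{succ S}(b₀, …, bₙ)`. [folklore] -/
theorem mono_comp_succ {F : Type*} [Field F] {n : ℕ} (S : Finset (Fin n))
    (b : Fin (n + 1) → Bool) :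
    mono F S (fun i => b i.succ) = mono F (S.map (Fin.succEmb n)) b := by
  simp only [Literature.Computability.MetaComplexity.Smolensky.mono]
  rw [Finset.prod_map]
  rfl

/-- The shift `g ↦ (b ↦ g(b₁, …, bₙ))` preserves the degree filtration: it is linear and sends the
monomial `x_S`, `|S| ≤ k`, to `x_{succ S}` with `|succ S| = |S| ≤ k`. [folklore] -/
theorem comp_succ_mem_lowDeg {F : Type*} [Field F] {n k : ℕ} {g : CubeFn F n}
    (hg : g ∈ lowDeg F n k) :
    (fun b : Fin (n + 1) → Bool => g (fun i => b i.succ)) ∈ lowDeg F (n + 1) k := by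
  rw [Literature.Computability.MetaComplexity.Smolensky.lowDeg_eq_span] at hg
  induction hg using Submodule.span_induction with
  | mem x hx =>
    obtain ⟨⟨S, hS⟩, rfl⟩ := hx
    have h : (fun b : Fin (n + 1) → Bool => mono F S (fun i => b i.succ)) =
        mono F (S.map (Fin.succEmb n)) :=
      funext fun b => mono_comp_succ S b
    rw [h]
    exact Literature.Computability.MetaComplexity.Smolensky.mono_mem_lowDeg
      (by rwa [Finset.card_map])
  | zero => exact Submodule.zero_mem _
  | add x y _ _ hx hy => exact Submodule.add_mem _ hx hy
  | smul c x _ hx => exact Submodule.smul_mem _ c hx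

/-- The indicator `[bᵢ = 0] = 1 - xᵢ = x_∅ - x_{i}` of a zero bit has degree `≤ 1`. [folklore] -/
theorem notBit_mem_lowDeg {F : Type*} [Field F] {m : ℕ} (i : Fin m) {D : ℕ} (hD : 1 ≤ D) :
    (fun b : Fin m → Bool => if b i then (0 : F) else 1) ∈ lowDeg F m D := by
  have h : (fun b : Fin m → Bool => if b i then (0 : F) else 1) = mono F ∅ - mono F {i} := by
    funext b
    simp only [Pi.sub_apply, Literature.Computability.MetaComplexity.Smolensky.mono,
      Finset.prod_empty, Finset.prod_singleton]
    split <;> simp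
  rw [h]
  exact Submodule.sub_mem _
    (Literature.Computability.MetaComplexity.Smolensky.mono_mem_lowDeg (by simp))
    (Literature.Computability.MetaComplexity.Smolensky.mono_mem_lowDeg (by simpa using hD))

end ShiftMapMem

/-- **The shift map raises the degree by one**: for `g ∈ lowDeg (ZMod 2) n k` the function
`b ↦ [b₀ = 0] · g(b₁, …, bₙ)` on the cube `{0,1}ⁿ⁺¹` lies in `lowDeg (ZMod 2) (n + 1) (k + 1)`
(`[b₀ = 0] = 1 - x₀` has degree `≤ 1`, the shifted `g` has degree `≤ k`, degrees add). [folklore] -/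
theorem stub_shiftMap_mem {n k : ℕ} (g : CubeFn (ZMod 2) n) (hg : g ∈ lowDeg (ZMod 2) n k) :
    (fun b : Fin (n + 1) → Bool => (if b 0 then (0 : ZMod 2) else 1) * g (fun i => b i.succ)) ∈
      lowDeg (ZMod 2) (n + 1) (k + 1) := by
  have h := Literature.Computability.MetaComplexity.Smolensky.mul_mem_lowDeg_add
    (ShiftMapMem.notBit_mem_lowDeg (F := ZMod 2) (0 : Fin (n + 1)) (le_refl 1))
    (ShiftMapMem.comp_succ_mem_lowDeg hg)
  rw [Nat.add_comm 1 k] at h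
  exact h

end Summit.QuantumAdvantage.DigitPolyUniformity.SketchLAR
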